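import Mathlib.RepresentationTheory.Basic
import Mathlib.LinearAlgebra.LinearIndependent.Lemmas
import Mathlib.Data.Fin.VecNotation
import Summits.HodgeConjecture.HodgeConjecture.Theorems.LinearSystemTorelliLocalTubeSpanFrameMod

/-!
# Route LinearSystemTorelli — crux `LocalTubeSpan`: pairing one (the cusp) is detected

Helper file (`--supports stmt-HodgeConjecture-2490`, line `Sketch`, stub `stub_rankTwoPairingOne`,
cycle 4 wave 2).  The line studies when Schnell's third map `H¹(G, ℚ²) → ∏_g ℚ²/(g - 1)ℚ²` is
injective ("cyclic detection") for a group generated by three symplectic transvections of `ℚ²`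
along the triangle `δ₁ = (1,0)`, `δ₂ = (0,1)`, `δ₃ = (1,1) = δ₁ + δ₂` with pairing `μ = ⟨δ₁, δ₂⟩`:

| `μ` | third map     | file                                  |
|-----|---------------|---------------------------------------|
| `1` | injective     | this file (frame argument, braid word) |
| `2` | injective     | `…RankTwoPairingTwo` (frame argument)  |
| `3` | injective     | `…RankTwoPairingThree` (a word)        |
| `4` | NOT injective | `…Thin` (the thin boundary)            |

Here `μ = 1` is the cusp `A₂` with the standard symplectic form `x₀y₁ - x₁y₀`:
`T₁(v) = (v₀ + v₁, v₁)`, `T₂(v) = (v₀, v₁ - v₀)`, `T₃(v) = v - (v₀ - v₁)(1, 1) = (v₁, 2v₁ - v₀)`,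
and the braid relation `T₃ = T₁ T₂ T₁⁻¹` puts `τ 2` in the frame group `⟨τ 0, τ 1⟩` up to an
element acting trivially, so Schnell's frame argument (C. Schnell, *Primitive cohomology and the
tube mapping*, Math. Z. 268 (2010) §7 Prop. 12, here through
`localTubeSpan_injective_evalCoinv_of_frame_mod_bot`: the discrepancy `τ₂ (τ₀τ₁τ₀⁻¹)⁻¹` acts
trivially) proves injectivity:

* `localTubeSpan_injective_evalCoinv_rankTwoPairingOne` — for ANY group generated by three elements
  acting on `ℚ²` as `T₁, T₂, T₃`, Schnell's third map is injective.

No named facts.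

References: [Schnell2010] C. Schnell, Primitive cohomology and the tube mapping, Math. Z. 268
(2010) §7 Prop. 12 (the frame argument).
-/

-- `Summit.HodgeConjecture.HodgeConjecture.Theorems` is the mandated namespace (single-conjunct summit:
-- Sub = Summit), which `linter.dupNamespace` flags on every declaration; the lakefile turns the
-- linter off tree-wide (weak option), restated here so stand-alone elaboration is warning-free too.
set_option linter.dupNamespace false

noncomputable section

open CategoryTheory groupCohomology
open Literature.AlgebraicGeometry.HodgeTheory

namespace Summit.HodgeConjecture.HodgeConjecture.Theorems

/-- **Pairing one is detected.**  Let a group `G` be generated by three elements `τ 0, τ 1, τ 2`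
acting on `ℚ²` as the transvections `T₁(v) = (v₀ + v₁, v₁)`, `T₂(v) = (v₀, v₁ - v₀)`,
`T₃(v) = v - (v₀ - v₁)(1,1)` (integral symplectic transvections of `x₀y₁ - x₁y₀` along
`(1,0), (0,1), (1,1)`, pairwise pairings `±1`: the cusp `A₂`).  Then Schnell's third map
`H¹(G, ℚ²) → ∏_{g ∈ G} ℚ²/(g - 1)ℚ²` is injective: the braid relation
`ρ(τ₂) = ρ(τ₀ τ₁ τ₀⁻¹)` shows that `τ₂` agrees with the frame-group element `τ₀ τ₁ τ₀⁻¹` up to an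
element acting trivially, and the frame theorem modulo `⊥` applies with the frame `(τ 0, τ 1)`
along the standard basis.
[cite: Schnell2010, §7 Prop. 12] -/
theorem localTubeSpan_injective_evalCoinv_rankTwoPairingOne {G : Type} [Group G]
    (ρ : Representation ℚ G (Fin 2 → ℚ)) (τ : Fin 3 → G)
    (hgen : Subgroup.closure (Set.range τ) = ⊤)
    (hτ₀ : ∀ v, ρ (τ 0) v = ![v 0 + v 1, v 1])
    (hτ₁ : ∀ v, ρ (τ 1) v = ![v 0, v 1 - v 0])
    (hτ₂ : ∀ v, ρ (τ 2) v = ![v 0 - (v 0 - v 1), v 1 - (v 0 - v 1)]) :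
    Function.Injective (evalCoinv (Rep.of ρ)) := by
  classical
  -- the cycles
  obtain ⟨d, hd0, hd1, hd2⟩ : ∃ d : Fin 3 → (Fin 2 → ℚ),
      d 0 = ![1, 0] ∧ d 1 = ![0, 1] ∧ d 2 = ![1, 1] := ⟨![![1, 0], ![0, 1], ![1, 1]], rfl, rfl, rfl⟩
  -- `(ρ (τ i) - 1) v ∈ ℚ d i` and `ρ (τ i)` fixes `d i`
  have hrange : ∀ (i : Fin 3) (v : Fin 2 → ℚ), ∃ c : ℚ, ρ (τ i) v - v = c • d i := by
    intro i v
    match i with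
    | 0 => exact ⟨v 1, by rw [hτ₀, hd0]; ext j; fin_cases j <;> simp⟩
    | 1 => exact ⟨-(v 0), by rw [hτ₁, hd1]; ext j; fin_cases j <;> simp⟩
    | 2 => exact ⟨-(v 0 - v 1), by rw [hτ₂, hd2]; ext j; fin_cases j <;> simp⟩
  have hfixd : ∀ i : Fin 3, ρ (τ i) (d i) = d i := by
    intro i
    match i with
    | 0 => rw [hτ₀, hd0]; ext j; fin_cases j <;> simp
    | 1 => rw [hτ₁, hd1]; ext j; fin_cases j <;> simp
    | 2 => rw [hτ₂, hd2]; ext j; fin_cases j <;> simp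
  have hsub : ∀ i : Fin 3, subOneRange (Rep.of ρ) (τ i) ≤ ℚ ∙ d i := by
    rintro i _ ⟨v, rfl⟩
    obtain ⟨c, hc⟩ := hrange i v
    change ρ (τ i) v - v ∈ ℚ ∙ d i
    rw [hc]
    exact Submodule.smul_mem _ _ (Submodule.mem_span_singleton_self _)
  -- the three generators are pairwise distinct (their actions differ on `(0, 1)`)
  have hval0 : ρ (τ 0) ![0, 1] = ![1, 1] := by rw [hτ₀]; ext j; fin_cases j <;> simp
  have hval1 : ρ (τ 1) ![0, 1] = ![0, 1] := by rw [hτ₁]; ext j; fin_cases j <;> simp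
  have hval2 : ρ (τ 2) ![0, 1] = ![1, 2] := by rw [hτ₂]; ext j; fin_cases j <;> norm_num
  have h01 : τ 0 ≠ τ 1 := fun h => by
    have h' := hval0
    rw [h, hval1] at h'
    exact absurd (congr_fun h' 0) (by norm_num)
  have h02 : τ 0 ≠ τ 2 := fun h => by
    have h' := hval0
    rw [h, hval2] at h'
    exact absurd (congr_fun h' 1) (by norm_num)
  have h12 : τ 1 ≠ τ 2 := fun h => by
    have h' := hval1
    rw [h, hval2] at h'
    exact absurd (congr_fun h' 0) (by norm_num)
  have hτinj : Function.Injective τ := by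
    intro i j hij
    match i, j with
    | 0, 0 => rfl
    | 1, 1 => rfl
    | 2, 2 => rfl
    | 0, 1 => exact absurd hij h01
    | 1, 0 => exact absurd hij.symm h01
    | 0, 2 => exact absurd hij h02
    | 2, 0 => exact absurd hij.symm h02
    | 1, 2 => exact absurd hij h12
    | 2, 1 => exact absurd hij.symm h12
  -- the cycle map on `G`: `e (τ i) = d i`
  let e : G → (Fin 2 → ℚ) := fun g => if hg : ∃ i, τ i = g then d (Classical.choose hg) else 0
  have he : ∀ i, e (τ i) = d i := fun i => by
    have hg : ∃ j, τ j = τ i := ⟨i, rfl⟩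
    change (if hg : ∃ j, τ j = τ i then d (Classical.choose hg) else 0) = d i
    rw [dif_pos hg, hτinj (Classical.choose_spec hg)]
  -- the inverse of the first generator and the braid relation `ρ (τ 2) = ρ (τ 0 τ 1 τ 0⁻¹)`
  have hinv : ∀ (g : G) (f : (Fin 2 → ℚ) → (Fin 2 → ℚ)), (∀ v, ρ g (f v) = v) →
      ∀ v, ρ g⁻¹ v = f v := by
    intro g f hf v
    have h2 : ρ g⁻¹ (ρ g (f v)) = f v := by
      rw [← Module.End.mul_apply, ← map_mul, inv_mul_cancel, map_one, Module.End.one_apply]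
    rwa [hf] at h2
  have hinv0 : ∀ v, ρ (τ 0)⁻¹ v = ![v 0 - v 1, v 1] :=
    hinv (τ 0) _ fun v => by rw [hτ₀]; ext j; fin_cases j <;> simp
  set w : G := τ 0 * τ 1 * (τ 0)⁻¹ with hwdef
  have hw : ∀ v, ρ (τ 2) v = ρ w v := fun v => by
    rw [hwdef, map_mul, map_mul, Module.End.mul_apply, Module.End.mul_apply, hinv0, hτ₁, hτ₀, hτ₂]
    ext j; fin_cases j <;> simp
  have heq : ρ (τ 2) = ρ w := LinearMap.ext hw
  -- the discrepancy acts trivially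
  have hκ : subOneRange (Rep.of ρ) (τ 2 * w⁻¹) ≤ ⊥ := by
    rintro _ ⟨v, rfl⟩
    change ρ (τ 2 * w⁻¹) v - v ∈ (⊥ : Submodule ℚ (Fin 2 → ℚ))
    rw [map_mul, heq, ← map_mul, mul_inv_cancel, map_one, Module.End.one_apply, sub_self]
    exact Submodule.zero_mem _
  -- the frame theorem modulo `⊥`
  refine localTubeSpan_injective_evalCoinv_of_frame_mod_bot (Rep.of ρ) (Set.range τ) hgen e
    (fun t ht => ?_) (fun t ht => ?_) ![τ 0, τ 1] ![d 0, d 1] ?_ (fun i => ?_) (fun t ht => ?_)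
  · obtain ⟨i, rfl⟩ := ht
    rw [he]
    exact hsub i
  · obtain ⟨i, rfl⟩ := ht
    rw [he]
    exact hfixd i
  · rw [LinearIndependent.pair_iff, hd0, hd1]
    intro a b hab
    have h0 := congr_fun hab 0
    have h1 := congr_fun hab 1
    simp at h0 h1
    exact ⟨h0, h1⟩
  · fin_cases i
    · exact hsub 0
    · exact hsub 1
  · obtain ⟨i, rfl⟩ := ht
    have hu0 : τ 0 ∈ Subgroup.closure (Set.range ![τ 0, τ 1] ∪
        {κ : G | subOneRange (Rep.of ρ) κ ≤ ⊥}) :=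
      Subgroup.subset_closure (Or.inl ⟨0, rfl⟩)
    have hu1 : τ 1 ∈ Subgroup.closure (Set.range ![τ 0, τ 1] ∪
        {κ : G | subOneRange (Rep.of ρ) κ ≤ ⊥}) :=
      Subgroup.subset_closure (Or.inl ⟨1, rfl⟩)
    match i with
    | 0 => exact ⟨1, one_pos, by rw [pow_one]; exact hu0⟩
    | 1 => exact ⟨1, one_pos, by rw [pow_one]; exact hu1⟩
    | 2 =>
      refine ⟨1, one_pos, ?_⟩
      have hwmem : w ∈ Subgroup.closure (Set.range ![τ 0, τ 1] ∪
          {κ : G | subOneRange (Rep.of ρ) κ ≤ ⊥}) := by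
        rw [hwdef]
        exact Subgroup.mul_mem _ (Subgroup.mul_mem _ hu0 hu1) (Subgroup.inv_mem _ hu0)
      have e1 : τ 2 ^ 1 = (τ 2 * w⁻¹) * w := by rw [pow_one, inv_mul_cancel_right]
      rw [e1]
      exact Subgroup.mul_mem _ (Subgroup.subset_closure (Or.inr hκ)) hwmem

end Summit.HodgeConjecture.HodgeConjecture.Theorems

end
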